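import Summits.HubbardSuperconductivity.HubbardSuperconductivity.Theses.ParentFirstSMA
import Literature.MathematicalPhysics.QuantumLattice.HubbardModelParticleHoleProofs

/-!
# Stub `stub_pairGap_sub_eq_twice_binding` (S3) of line `birth`
# (crux `BoundCoherentDWavePairs`, item stmt-HubbardSuperconductivity-10770, route `ParentFirstSMA`)

On the even torus `(ℤ/Lℤ)²`, `L ≥ 2`, write `E(N) = groundEnergyAt (fermionTorusGraph 2 L) 1 U N`,
`Δ_c(L) = chargeGap … (L²) = E(L²+1) + E(L²−1) − 2E(L²)` (one-particle charge gap at half filling)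
and `Δ_p(L) = E(L²+2) + E(L²−2) − 2E(L²)` (two-particle charge gap). The particle–hole identity
`E(N) = E(2L² − N) − (L² − N)·U` (`groundEnergyAt_fermionTorus_particleHole`, Lieb–Wu 2003 eq. (3))
at `N = L² − 1` and `N = L² − 2` gives `E(L²+1) = E(L²−1) + U`, `E(L²+2) = E(L²−2) + 2U`, whence
`2Δ_c(L) − Δ_p(L) = 2·[2E(L²−1) − E(L²) − E(L²−2)]` EXACTLY — `U` cancels. The right-hand side is
twice the two-hole binding energy of clause (i) of the crux: "binding" is "the pair level sits
strictly inside twice the one-particle continuum edge".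

No definitions are introduced.
-/

-- the mandated namespace `Summit.<Summit>.<Problem>.Theorems` repeats `HubbardSuperconductivity`
set_option linter.dupNamespace false

noncomputable section

namespace Summit.HubbardSuperconductivity.HubbardSuperconductivity.Theorems.ParentFirstSMA

open Literature.MathematicalPhysics.QuantumLattice

/-- Particle–hole symmetry on the even torus, shifted form: for even `L` and `j ≤ L²`,
`E(L² + j) = E(L² − j) + j·U`. [cite: LiebWuPhysicaA2003, §1 eq. (3)] -/
theorem groundEnergyAt_fermionTorus2_halfFilling_add {L : ℕ} (hL : Even L) (U : ℝ) {j : ℕ}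
    (hj : j ≤ L ^ 2) :
    groundEnergyAt (fermionTorusGraph 2 L) 1 U (L ^ 2 + j) =
      groundEnergyAt (fermionTorusGraph 2 L) 1 U (L ^ 2 - j) + (j : ℝ) * U := by
  have hph := groundEnergyAt_fermionTorus_particleHole (d := 2) hL 1 U (N := L ^ 2 - j) (by omega)
  have hK : 2 * L ^ 2 - (L ^ 2 - j) = L ^ 2 + j := by omega
  rw [hK] at hph
  have hcast : ((L : ℝ) ^ 2 - ((L ^ 2 - j : ℕ) : ℝ)) = (j : ℝ) := by
    rw [Nat.cast_sub hj]
    push_cast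
    ring
  rw [hcast] at hph
  linarith

/-- **Stub S3 of line `birth` (crux `BoundCoherentDWavePairs`, stmt-HubbardSuperconductivity-10770):
pair gap versus binding.** On the even torus of side `L ≥ 2`, for every `U`,
`2Δ_c(L) − Δ_p(L) = 2·[2E(L²−1) − E(L²) − E(L²−2)]`, where `Δ_c(L) = chargeGap … (L²)` and
`Δ_p(L) = E(L²+2) + E(L²−2) − 2E(L²)`: the particle–hole identities `E(L²+1) = E(L²−1) + U`,
`E(L²+2) = E(L²−2) + 2U`; `U` cancels. [cite: LiebWuPhysicaA2003, §1 eq. (3)] -/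
theorem stub_pairGap_sub_eq_twice_binding :
    ∀ (U : ℝ) (L : ℕ), Even L → 2 ≤ L →
      2 * chargeGap (fermionTorusGraph 2 L) 1 U (L ^ 2) -
          (groundEnergyAt (fermionTorusGraph 2 L) 1 U (L ^ 2 + 2) +
            groundEnergyAt (fermionTorusGraph 2 L) 1 U (L ^ 2 - 2) -
            2 * groundEnergyAt (fermionTorusGraph 2 L) 1 U (L ^ 2)) =
        2 * (2 * groundEnergyAt (fermionTorusGraph 2 L) 1 U (L ^ 2 - 1) -
          groundEnergyAt (fermionTorusGraph 2 L) 1 U (L ^ 2) -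
          groundEnergyAt (fermionTorusGraph 2 L) 1 U (L ^ 2 - 2)) := by
  intro U L hL h2
  have h4 : 4 ≤ L ^ 2 := by
    calc (4 : ℕ) = 2 ^ 2 := by norm_num
      _ ≤ L ^ 2 := Nat.pow_le_pow_left h2 2
  have h1 := groundEnergyAt_fermionTorus2_halfFilling_add hL U (j := 1) (by omega)
  have h2' := groundEnergyAt_fermionTorus2_halfFilling_add hL U (j := 2) (by omega)
  unfold chargeGap
  rw [h1, h2']
  push_cast
  ring

end Summit.HubbardSuperconductivity.HubbardSuperconductivity.Theorems.ParentFirstSMA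

end
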